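import Summits.QuantumFields.YangMills.Theorems.SwapVirialDeficitTwoScaleCalculusMin
import HarnessLib

/-!
# RAY MINORANTS BOUND THE SECOND DERIVATIVE FROM BELOW: `γ ≤ φ`, `γ(0) = φ(0)` ⟹ `γ″(0) ≤ φ″(0)`; and `(s²·h(s))″(0) = 2h(0)`
# (generic; free-hands support of ⟨stmt-QuantumFields-24197⟩ `SwapVirialDeficit.SwapGluedStiffness` — the ANISOTROPIC fibre-coercivity step of stub S3∕S4
# «finiteness of the bottom measure» of fcl-p3 g47's sector skeleton)

LEAD ym-line-sfw-p2 g97's original W3 recipe («a global inequality between two functions that agree at a common minimum passes to Hessians», ✓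
`TwoScaleCalculusMin.hess_nonneg_of_isMinOn` ∕ ✓`iteratedDeriv_two_nonneg_of_isMinOn`) in the ray dialect of the gnomonic fibre package: every GLOBAL smooth
minorant `γ ≤ φ` of the deficit along a fibre ray that touches it at the base point contributes its own second derivative to the Hessian floor, and the
explicit minorants of the tree (hub weight ✓`leadersW_hubStiff_le`, follower Frobenius floor ✓`sum_follower_frobNorm_sq_le_chartDeficit`, commutator floor
✓`gnoDeficit_one_ge_cross`) are all of the form `s² · h(s)` along rays:
* `iteratedDeriv_two_sub` (`C²` functions), ★ `iteratedDeriv_two_ge_of_minorant` (`γ, φ ∈ C^∞`, `γ ≤ φ`, `γ 0 = φ 0` ⟹ `γ″(0) ≤ φ″(0)`),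
  ★ `iteratedDeriv_two_ge_of_three_minorants` (three minorants ⟹ `φ″(0) ≥ (γ₁″ + γ₂″ + γ₃″)(0)/3`);
* ★ `iteratedDeriv_two_sq_mul` (`h ∈ C²` ⟹ `(s ↦ s²h(s))″(0) = 2h(0)`), `contDiff_sq_mul`.

HONEST LABEL: one-variable calculus; nothing about any Gibbs state; S3∕S4∕S5, ⟨24197⟩ ∕ ⟨24194⟩ ∕ ⟨24497⟩ OPEN; own crux ⟨22884⟩ OPEN (blocked-on ⟨19935⟩); the
Yang–Mills mass gap is NOT proved; no summit is proved by a line.  THEOREMS ONLY (0 `def`, 0 `sorry`), standard axioms.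
Width seat ym-line-sfw-p2-w3 g66 (cell ym-idea-1, free hands), `--supports stmt-QuantumFields-24197`.  References: [folklore].
-/

set_option autoImplicit false

noncomputable section

open Filter Topology
open scoped ContDiff

namespace Summit.QuantumFields.YangMills.Theorems.QuantitativeLaplace

open Summit.QuantumFields.YangMills.Theorems.SwapVirialDeficit.TwoScaleCalculus (iteratedDeriv_two_nonneg_of_isMinOn)

/-- `iteratedDeriv 2 (φ − γ) 0 = iteratedDeriv 2 φ 0 − iteratedDeriv 2 γ 0` for `C²` functions. [folklore] -/
theorem iteratedDeriv_two_sub {φ γ : ℝ → ℝ} (hφ : ContDiff ℝ 2 φ) (hγ : ContDiff ℝ 2 γ) :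
    iteratedDeriv 2 (fun s => φ s - γ s) 0 = iteratedDeriv 2 φ 0 - iteratedDeriv 2 γ 0 := by
  have hφ1 : Differentiable ℝ φ := hφ.differentiable (by norm_num)
  have hγ1 : Differentiable ℝ γ := hγ.differentiable (by norm_num)
  have hφ2 : Differentiable ℝ (deriv φ) := hφ.differentiable_deriv_two
  have hγ2 : Differentiable ℝ (deriv γ) := hγ.differentiable_deriv_two
  have h1 : deriv (fun s => φ s - γ s) = fun s => deriv φ s - deriv γ s := by
    funext s
    exact deriv_sub (hφ1 s) (hγ1 s)
  rw [iteratedDeriv_succ, iteratedDeriv_one, iteratedDeriv_succ, iteratedDeriv_one, iteratedDeriv_succ, iteratedDeriv_one, h1]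
  exact deriv_sub (hφ2 0) (hγ2 0)

/-- ★ **A touching smooth minorant bounds the second derivative from below**: `γ, φ ∈ C^∞`, `γ ≤ φ` everywhere, `γ 0 = φ 0` ⟹ `γ″(0) ≤ φ″(0)`
(✓`iteratedDeriv_two_nonneg_of_isMinOn` for `φ − γ`). [folklore] -/
theorem iteratedDeriv_two_ge_of_minorant {φ γ : ℝ → ℝ} (hφ : ContDiff ℝ ∞ φ) (hγ : ContDiff ℝ ∞ γ) (hle : ∀ s, γ s ≤ φ s) (h0 : γ 0 = φ 0) :
    iteratedDeriv 2 γ 0 ≤ iteratedDeriv 2 φ 0 := by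
  have hd : ContDiff ℝ ∞ (fun s => φ s - γ s) := hφ.sub hγ
  have hmin : ∀ t, (fun s => φ s - γ s) 0 ≤ (fun s => φ s - γ s) t := fun t => by simp only [h0, sub_self]; linarith [hle t]
  have h := iteratedDeriv_two_nonneg_of_isMinOn hd hmin
  rw [iteratedDeriv_two_sub (hφ.of_le (by norm_cast)) (hγ.of_le (by norm_cast))] at h
  linarith

/-- ★ **Three touching minorants**: `γᵢ ≤ φ`, `γᵢ 0 = φ 0` (`i = 1,2,3`) ⟹ `φ″(0) ≥ (γ₁″(0) + γ₂″(0) + γ₃″(0))/3` (the minorant `(γ₁+γ₂+γ₃)/3`). [folklore] -/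
theorem iteratedDeriv_two_ge_of_three_minorants {φ γ₁ γ₂ γ₃ : ℝ → ℝ} (hφ : ContDiff ℝ ∞ φ) (h₁ : ContDiff ℝ ∞ γ₁) (h₂ : ContDiff ℝ ∞ γ₂)
    (h₃ : ContDiff ℝ ∞ γ₃) (hle₁ : ∀ s, γ₁ s ≤ φ s) (hle₂ : ∀ s, γ₂ s ≤ φ s) (hle₃ : ∀ s, γ₃ s ≤ φ s)
    (h0₁ : γ₁ 0 = φ 0) (h0₂ : γ₂ 0 = φ 0) (h0₃ : γ₃ 0 = φ 0) :
    (iteratedDeriv 2 γ₁ 0 + iteratedDeriv 2 γ₂ 0 + iteratedDeriv 2 γ₃ 0) / 3 ≤ iteratedDeriv 2 φ 0 := by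
  set γ : ℝ → ℝ := fun s => (1 / 3 : ℝ) * (γ₁ s + γ₂ s + γ₃ s) with hγ
  have hγd : ContDiff ℝ ∞ γ := contDiff_const.mul ((h₁.add h₂).add h₃)
  have hle : ∀ s, γ s ≤ φ s := fun s => by simp only [hγ]; linarith [hle₁ s, hle₂ s, hle₃ s]
  have h0 : γ 0 = φ 0 := by simp only [hγ, h0₁, h0₂, h0₃]; ring
  have h := iteratedDeriv_two_ge_of_minorant hφ hγd hle h0
  -- `γ″ = (γ₁″ + γ₂″ + γ₃″)/3`
  have h2 : (2 : WithTop ℕ∞) ≤ ∞ := by norm_cast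
  have e12 : iteratedDeriv 2 (fun s => γ₁ s + γ₂ s + γ₃ s) 0 = iteratedDeriv 2 γ₁ 0 + iteratedDeriv 2 γ₂ 0 + iteratedDeriv 2 γ₃ 0 := by
    have ha : iteratedDeriv 2 (fun s => (γ₁ s + γ₂ s + γ₃ s) - γ₃ s) 0 = iteratedDeriv 2 (fun s => γ₁ s + γ₂ s + γ₃ s) 0 - iteratedDeriv 2 γ₃ 0 :=
      iteratedDeriv_two_sub (((h₁.add h₂).add h₃).of_le h2) (h₃.of_le h2)
    have hb : iteratedDeriv 2 (fun s => (γ₁ s + γ₂ s) - γ₂ s) 0 = iteratedDeriv 2 (fun s => γ₁ s + γ₂ s) 0 - iteratedDeriv 2 γ₂ 0 :=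
      iteratedDeriv_two_sub ((h₁.add h₂).of_le h2) (h₂.of_le h2)
    simp only [add_sub_cancel_right] at ha hb
    have hb' : iteratedDeriv 2 (fun s => γ₁ s + γ₂ s) 0 = iteratedDeriv 2 γ₁ 0 + iteratedDeriv 2 γ₂ 0 := by
      have : (fun s => γ₁ s) = γ₁ := rfl
      rw [this] at hb; linarith
    have ha' : iteratedDeriv 2 (fun s => γ₁ s + γ₂ s + γ₃ s) 0 = iteratedDeriv 2 (fun s => γ₁ s + γ₂ s) 0 + iteratedDeriv 2 γ₃ 0 := by linarith
    rw [ha', hb']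
  have e : iteratedDeriv 2 γ 0 = (1 / 3 : ℝ) * (iteratedDeriv 2 γ₁ 0 + iteratedDeriv 2 γ₂ 0 + iteratedDeriv 2 γ₃ 0) := by
    rw [hγ, iteratedDeriv_const_mul _ (((h₁.add h₂).add h₃).contDiffAt.of_le h2), e12]
  rw [e] at h
  linarith

/-- `s ↦ s²·h(s)` is `Cⁿ` when `h` is. [folklore] -/
theorem contDiff_sq_mul {h : ℝ → ℝ} {n : WithTop ℕ∞} (hh : ContDiff ℝ n h) : ContDiff ℝ n fun s => s ^ 2 * h s :=
  (contDiff_id.pow 2).mul hh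

/-- ★ **`(s²·h(s))″(0) = 2·h(0)`** for `h ∈ C²`. [folklore] -/
theorem iteratedDeriv_two_sq_mul {h : ℝ → ℝ} (hh : ContDiff ℝ 2 h) : iteratedDeriv 2 (fun s => s ^ 2 * h s) 0 = 2 * h 0 := by
  have hh1 : Differentiable ℝ h := hh.differentiable (by norm_num)
  have hh2 : Differentiable ℝ (deriv h) := hh.differentiable_deriv_two
  -- first derivative everywhere
  have hd1 : ∀ s, HasDerivAt (fun s => s ^ 2 * h s) (2 * s * h s + s ^ 2 * deriv h s) s := by
    intro s
    have hp : HasDerivAt (fun s : ℝ => s ^ 2) (2 * s) s := by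
      have := hasDerivAt_pow 2 s
      simp only [Nat.cast_ofNat, Nat.add_one_sub_one, pow_one] at this
      exact this
    have hm := hp.fun_mul (hh1 s).hasDerivAt
    have e : 2 * s * h s + s ^ 2 * deriv h s = 2 * s * h s + s ^ 2 * deriv h s := rfl
    exact hm
  have e1 : deriv (fun s => s ^ 2 * h s) = fun s => 2 * s * h s + s ^ 2 * deriv h s := funext fun s => (hd1 s).deriv
  rw [iteratedDeriv_succ, iteratedDeriv_one, e1]
  -- second derivative at 0
  have hA : HasDerivAt (fun s : ℝ => 2 * s * h s) (2 * 1 * h 0 + 2 * 0 * deriv h 0) 0 := by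
    have h2s : HasDerivAt (fun s : ℝ => 2 * s) (2 * 1) 0 := (hasDerivAt_id (0 : ℝ)).const_mul 2
    exact h2s.fun_mul (hh1 0).hasDerivAt
  have hB : HasDerivAt (fun s : ℝ => s ^ 2 * deriv h s) (2 * 0 * deriv h 0 + 0 ^ 2 * deriv (deriv h) 0) 0 := by
    have hp : HasDerivAt (fun s : ℝ => s ^ 2) (2 * 0) 0 := by
      have := hasDerivAt_pow 2 (0 : ℝ)
      simp only [Nat.cast_ofNat, Nat.add_one_sub_one, pow_one] at this
      exact this
    exact hp.fun_mul (hh2 0).hasDerivAt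
  have hsum := hA.fun_add hB
  rw [hsum.deriv]
  ring

end Summit.QuantumFields.YangMills.Theorems.QuantitativeLaplace

end
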